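import Mathlib
import HarnessLib
import Literature.Analysis.FluidPDE.SelfSimilar
import Literature.Analysis.FluidPDE.LocalTypeI
import Literature.Analysis.FluidPDE.VectorCalculus
import Literature.Analysis.FluidPDE.VorticityCalculus
import Literature.Analysis.FluidPDE.TypeIAncientMild
import Literature.Analysis.FluidPDE.AncientMildWeak
import Literature.Analysis.FluidPDE.KNSSRegularity
import Literature.Analysis.FluidPDE.KNSSRegularityProofs
import Literature.Analysis.FluidPDE.KNSSLiouvillePlanarHolds
import Literature.Analysis.FluidPDE.AxisymNoSwirlVorticity
import Literature.Analysis.FluidPDE.SteadyLiouvilleTsaiVorticity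
import Literature.Analysis.FluidPDE.KNSSThm52Assembly
import Literature.Analysis.UnboundedOperators.HeatKernel
import Summits.NavierStokesRegularity.NavierStokesRegularity.Theorems.LocalSineTubeDoorProfileAlignedWindowRigidityAncient
import Summits.NavierStokesRegularity.NavierStokesRegularity.Theorems.SymmetryModuliCountSymmetricLiouvilleSelfSimilarLeaf
import Summits.NavierStokesRegularity.NavierStokesRegularity.Theorems.PoloidalWindowDoorPoloidalWindowRigidityWindow
import Summits.NavierStokesRegularity.NavierStokesRegularity.Theorems.PoloidalWindowDoorPoloidalWindowRigidityErtelCollapseKNSS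

/-!
# Route `PoloidalWindowDoor` (crux `PoloidalWindowRigidity`) and route `LocalVelCompTubeDoor` (S10, crux
# `VelCompWindowRigidity`) — ERTEL COLLAPSE, part 2: the frozen constraint already forces poloidality
# (`⟪Dv·ω, e₃⟫ ≡ 0 ⇒ ω₃ ≡ 0` for Type-I profiles)

Cell ns-regularity-ideate, seat p6 (route-directed support). For a profile `v` of the routes' Type-I class (rate
`‖v(t,x)‖ ≤ C/√(−t)`, continuous on the open slab, unit-viscosity Oseen-mild, divergence-free slices) the third
component of the vorticity `q = ω₃` solves `qₜ + v·∇q − Δq = ⟪Dv ω, e₃⟫`. If the right-hand side vanishes identically —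
the FROZEN CONSTRAINT of the poloidal stratum (`…FirstIntegral.stub_firstIntegral` is the converse), in particular if
`v₃ ≡ 0` (S10's stub `stub_ertelCollapse`) — then `q ≡ 0`: after the time shift `t ↦ t − δ` the profile is a bounded
ancient mild, hence bounded weak, solution (`IsBoundedAncientMildSolution.isBoundedWeakNSSolutionOn`); KNSS §4
(`KNSS2009_regularity_boundedWeak_ancient_holds`) provides the regular representative `U + b(t)`, equal to the
(continuous) shifted profile on a.e. slice; the companion file `…ErtelCollapseKNSS` kills `(curl U)₂`
(`curl_apply_two_eq_zero_of_lemma21`: Lemma 2.1 on `ℝ³` + planar flux on horizontal discs); time-continuity of `ω₃`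
(joint smoothness of the profile) upgrades "a.e. slice" to "every slice":

* `continuousOn_fderiv_slice_apply`, `continuousOn_curl_apply_two`, `eq_zero_of_ae_of_continuousOn` — the upgrade;
* `curl_two_eq_zero_of_stretching_two_eq_zero` — THE COLLAPSE for profiles of the class;
* `curl_two_eq_zero_of_apply_two_eq_zero` — S10's STUB 3 (`v₃ ≡ 0 ⇒ ω₃ ≡ 0`);
* `poloidal_iff_frozen` — `ω₃ ≡ 0 ↔ ⟪Dv ω, e₃⟫ ≡ 0` on the class (nsreg-p1 ROUND-9 «Ertel collapse 𝒞_e = poloidal»).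

WHAT THIS IS NOT: not a claim about Navier–Stokes regularity and not the open residue of K2 — a Liouville-type lemma
for ONE vorticity component under the frozen constraint, for STAGED/DRAFT door routes of LADDER-NS N0.
-/

noncomputable section

-- the summit and its single sub-problem share the name (CONVENTIONS §1), as in every Theorems file
set_option linter.dupNamespace false

namespace Summit.NavierStokesRegularity.NavierStokesRegularity.Theorems.PoloidalWindowDoorPoloidalWindowRigidityErtelCollapse

open MeasureTheory Set Function Filter Topology TopologicalSpace Metric WithLp InnerProductSpace
open scoped RealInnerProductSpace InnerProductSpace Laplacian ContDiff
open Literature.Analysis Literature.Analysis.FluidPDE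
open Summit.NavierStokesRegularity.NavierStokesRegularity.Theorems.LocalSineTubeDoorProfileAlignedWindowRigidityAncient
open Summit.NavierStokesRegularity.NavierStokesRegularity.Theorems.PoloidalWindowDoorPoloidalWindowRigidityWindow
open Summit.NavierStokesRegularity.NavierStokesRegularity.Theorems.PoloidalWindowDoorPoloidalWindowRigidityErtelCollapseKNSS

/-! ### the collapse for profiles of the Type-I class -/

variable {C : ℝ} {v : ℝ → EuclideanSpace ℝ (Fin 3) → EuclideanSpace ℝ (Fin 3)}

/-- Time-continuity of the slice Jacobian of a profile of the class at a fixed point (joint smoothness on the slab). -/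
theorem continuousOn_fderiv_slice_apply (hA : IsTypeIAncientMild C v) (y w : EuclideanSpace ℝ (Fin 3)) :
    ContinuousOn (fun t => fderiv ℝ (v t) y w) (Iio 0) := by
  have hD : ContinuousOn (fderiv ℝ (uncurry v)) (Iio (0 : ℝ) ×ˢ (univ : Set (EuclideanSpace ℝ (Fin 3)))) :=
    hA.contDiffOn.continuousOn_fderiv_of_isOpen (isOpen_Iio.prod isOpen_univ) (by exact_mod_cast le_top)
  have hι : ContinuousOn (fun t : ℝ => ((t, y) : ℝ × EuclideanSpace ℝ (Fin 3))) (Iio 0) :=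
    (continuous_id.prodMk continuous_const).continuousOn
  have hmaps : MapsTo (fun t : ℝ => ((t, y) : ℝ × EuclideanSpace ℝ (Fin 3))) (Iio 0)
      (Iio (0 : ℝ) ×ˢ (univ : Set (EuclideanSpace ℝ (Fin 3)))) := fun t ht => mem_prod.2 ⟨ht, mem_univ _⟩
  have h1 : ContinuousOn (fun t : ℝ => fderiv ℝ (uncurry v) (t, y) ((0 : ℝ), w)) (Iio 0) :=
    ((ContinuousLinearMap.apply ℝ (EuclideanSpace ℝ (Fin 3)) ((0 : ℝ), w)).continuous.comp_continuousOn
      (hD.comp hι hmaps))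
  refine h1.congr fun t ht => ?_
  exact Summit.NavierStokesRegularity.NavierStokesRegularity.Theorems.SymmetryModuliCountSymmetricLiouville.SelfSimilarLeaf.fderiv_slice_eq_fderiv_uncurry_of_slab
    hA.contDiffOn ht y w

/-- Time-continuity of the third vorticity component of a profile of the class at a fixed point. -/
theorem continuousOn_curl_apply_two (hA : IsTypeIAncientMild C v) (y : EuclideanSpace ℝ (Fin 3)) :
    ContinuousOn (fun t => curl (v t) y 2) (Iio 0) := by
  have h0 := continuousOn_fderiv_slice_apply hA y (EuclideanSpace.single 0 1)
  have h1 := continuousOn_fderiv_slice_apply hA y (EuclideanSpace.single 1 1)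
  have hc0 : ContinuousOn (fun t => fderiv ℝ (v t) y (EuclideanSpace.single 0 1) 1) (Iio 0) :=
    (EuclideanSpace.proj (1 : Fin 3)).continuous.comp_continuousOn h0
  have hc1 : ContinuousOn (fun t => fderiv ℝ (v t) y (EuclideanSpace.single 1 1) 0) (Iio 0) :=
    (EuclideanSpace.proj (0 : Fin 3)).continuous.comp_continuousOn h1
  simp_rw [curl_apply_two]
  exact hc0.sub hc1

/-- A function continuous on `(−∞,0)` that vanishes for a.e. `t < 0` vanishes for every `t < 0`. -/
theorem eq_zero_of_ae_of_continuousOn {φ : ℝ → ℝ} (hφ : ContinuousOn φ (Iio 0))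
    (hae : ∀ᵐ t ∂(volume.restrict (Iio (0 : ℝ))), φ t = 0) : ∀ t < 0, φ t = 0 := by
  intro t₀ ht₀
  by_contra hne
  have hae' : ∀ᵐ t ∂(volume : Measure ℝ), t ∈ Iio (0 : ℝ) → φ t = 0 := (ae_restrict_iff' measurableSet_Iio).1 hae
  -- an open interval around `t₀` inside `(−∞,0)` on which `φ ≠ 0`
  have hct : ContinuousAt φ t₀ := hφ.continuousAt (isOpen_Iio.mem_nhds ht₀)
  have hopen : ∀ᶠ t in 𝓝 t₀, φ t ≠ 0 := hct.eventually_ne hne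
  obtain ⟨ε, hε, hball⟩ := Metric.eventually_nhds_iff_ball.1 (hopen.and (isOpen_Iio.eventually_mem ht₀))
  have hnull : volume (ball t₀ ε) = 0 := by
    refine measure_mono_null (fun t ht => ?_) (ae_iff.1 hae')
    obtain ⟨h1, h2⟩ := hball t ht
    exact fun h => h1 (h h2)
  exact absurd hnull (measure_ball_pos volume t₀ hε).ne'

/-- **ERTEL COLLAPSE for Type-I profiles** (the frozen constraint forces poloidality). Let `v` be a profile of the
route's Type-I class (rate, continuity on the open slab, unit-viscosity Oseen-mild identity, divergence-free slices).
If the third component of the vortex stretching vanishes identically, `⟪Dv(s)(y) ω(s,y), e₃⟫ = 0` for all `s < 0`,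
`y`, then the third vorticity component vanishes identically: `ω₃ ≡ 0`, i.e. `v` is poloidal along `e₃`. (After every
time shift `δ > 0` the profile is a bounded ancient mild — hence bounded weak — solution; KNSS §4 gives the regular
representative, `curl_apply_two_eq_zero_of_lemma21` kills `(curl U)₂`, and time-continuity of `ω₃` upgrades "a.e.
slice" to "every slice".) -/
theorem curl_two_eq_zero_of_stretching_two_eq_zero (hrate : HasTypeITimeDecay C v)
    (hcont : ContinuousOn (uncurry v) (Iio (0 : ℝ) ×ˢ univ))
    (hmild : ∀ s t : ℝ, s < t → t < 0 → ∀ x,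
      v t x = UnboundedOperators.heatExtension (v s) (t - s) x - oseenDuhamel 1 s v v t x)
    (hdiv : ∀ t < 0, VectorCalculus.IsDivFree (v t))
    (hfrozen : ∀ s < 0, ∀ y, ⟪fderiv ℝ (v s) y (curl (v s) y), EuclideanSpace.single 2 1⟫_ℝ = 0) :
    ∀ s < 0, ∀ y, curl (v s) y 2 = 0 := by
  have hA : IsTypeIAncientMild C v := isTypeIAncientMild_of_class hrate hcont hmild hdiv
  -- ## every shifted slab: `(curl v(τ − δ))₂ = 0` for a.e. `τ < 0`
  have key : ∀ δ : ℝ, 0 < δ → ∀ᵐ τ ∂(volume.restrict (Iio (0 : ℝ))), ∀ y, curl (v (τ - δ)) y 2 = 0 := by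
    intro δ hδ
    -- the shifted profile is a bounded ancient mild, hence bounded weak, solution
    have hAu : IsTypeIAncientMild C (fun t => v (t - δ)) := hA.comp_sub_right hδ.le
    have hw : IsBoundedAncientMildSolution 1 (fun t => v (t - δ)) := hA.isBoundedAncientMildSolution_sub hδ
    have hmeas : AEStronglyMeasurable (uncurry fun t => v (t - δ))
        ((volume : Measure (ℝ × EuclideanSpace ℝ (Fin 3))).restrict (Iio 0 ×ˢ univ)) :=
      hAu.continuousOn_uncurry.aestronglyMeasurable (measurableSet_Iio.prod MeasurableSet.univ)
    have hsl : ∀ t < 0, AEStronglyMeasurable ((fun t => v (t - δ)) t) volume :=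
      fun t ht => (hAu.continuous_slice ht).aestronglyMeasurable
    have hweak := hw.isBoundedWeakNSSolutionOn one_pos hmeas hsl
    obtain ⟨U, b, hbm, hbC, hUm, hae, hsmooth, -, hbd, hlip, hvort⟩ :=
      KNSS2009_regularity_boundedWeak_ancient_holds hweak
    have hmemI : ∀ᵐ t ∂(volume.restrict (Iio (0 : ℝ))), t ∈ Iio (0 : ℝ) := ae_restrict_mem measurableSet_Iio
    -- for a.e. `t < 0` the continuous slices agree everywhere
    have hae' : ∀ᵐ t ∂(volume.restrict (Iio (0 : ℝ))), ∀ x, v (t - δ) x = U t x + b t := by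
      filter_upwards [hae, hmemI] with t ht htI
      have hcu : Continuous (v (t - δ)) := hAu.continuous_slice htI
      have hcU : Continuous (fun x => U t x + b t) := (hsmooth t htI).continuous.add continuous_const
      have h := (hcu.ae_eq_iff_eq volume hcU).1 ht
      exact fun x => congrFun h x
    have hUeq : ∀ t, (∀ x, v (t - δ) x = U t x + b t) → U t = fun x => v (t - δ) x + (-b t) := by
      intro t ht
      funext x
      rw [ht x]
      abel
    -- the third component of the stretching of `U` vanishes for a.e. `t`
    have hstr : ∀ᵐ τ ∂(volume.restrict (Iio (0 : ℝ))), ∀ x, fderiv ℝ (U τ) x (curl (U τ) x) 2 = 0 := by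
      filter_upwards [hae', hmemI] with τ hτ hτI
      intro x
      have hτ0 : τ < 0 := hτI
      have hD : fderiv ℝ (U τ) x = fderiv ℝ (v (τ - δ)) x := by
        rw [hUeq τ hτ, fderiv_add_const]
      have hC : curl (U τ) x = curl (v (τ - δ)) x := by
        rw [hUeq τ hτ, curl_add_const_eq]
      rw [hD, hC]
      have h := hfrozen (τ - δ) (by linarith) x
      simpa [EuclideanSpace.inner_single_right] using h
    have hcollapse := curl_apply_two_eq_zero_of_lemma21
      (KNSS2009_lemma21_halfball_holds (E := EuclideanSpace ℝ (Fin 3))) hbm hbC hUm hsmooth hbd hlip hvort hstr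
    filter_upwards [hae', hmemI] with τ hτ hτI
    intro y
    have hC : curl (v (τ - δ)) y = curl (U τ) y := by
      rw [hUeq τ hτ, curl_add_const_eq]
    rw [hC]
    exact hcollapse τ hτI y
  -- ## from a.e. slices to every slice, by time-continuity of `ω₃`
  intro s hs y
  set δ : ℝ := -s / 2 with hδ
  have hδ0 : 0 < δ := by rw [hδ]; linarith
  have hAu : IsTypeIAncientMild C (fun t => v (t - δ)) := hA.comp_sub_right hδ0.le
  have hφ : ContinuousOn (fun t => curl (v (t - δ)) y 2) (Iio 0) := continuousOn_curl_apply_two hAu y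
  have hae : ∀ᵐ t ∂(volume.restrict (Iio (0 : ℝ))), curl (v (t - δ)) y 2 = 0 := by
    filter_upwards [key δ hδ0] with t ht using ht y
  have h := eq_zero_of_ae_of_continuousOn hφ hae (s / 2) (by linarith)
  have hs2 : s / 2 - δ = s := by rw [hδ]; ring
  rwa [hs2] at h

/-- **S10's STUB 3 (`stub_ertelCollapse`): `v₃ ≡ 0 ⇒ ω₃ ≡ 0`** for profiles of the class — the third component of
the stretching is `D(v₃)[ω] = 0`. -/
theorem curl_two_eq_zero_of_apply_two_eq_zero (hrate : HasTypeITimeDecay C v)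
    (hcont : ContinuousOn (uncurry v) (Iio (0 : ℝ) ×ˢ univ))
    (hmild : ∀ s t : ℝ, s < t → t < 0 → ∀ x,
      v t x = UnboundedOperators.heatExtension (v s) (t - s) x - oseenDuhamel 1 s v v t x)
    (hdiv : ∀ t < 0, VectorCalculus.IsDivFree (v t))
    (h3 : ∀ s < 0, ∀ y, v s y 2 = 0) : ∀ s < 0, ∀ y, curl (v s) y 2 = 0 := by
  have hA : IsTypeIAncientMild C v := isTypeIAncientMild_of_class hrate hcont hmild hdiv
  refine curl_two_eq_zero_of_stretching_two_eq_zero hrate hcont hmild hdiv fun s hs y => ?_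
  have hd : Differentiable ℝ (v s) := (hA.contDiff_slice hs).differentiable (by simp)
  have hz : (fun w => v s w 2) = fun _ => (0 : ℝ) := funext fun w => h3 s hs w
  have h0 : fderiv ℝ (v s) y (curl (v s) y) 2 = 0 := by
    rw [Tsai2021.fderiv_apply_coord hd, hz]
    simp
  simp [EuclideanSpace.inner_single_right, h0]

/-- **`𝒞_{e₃}` = poloidal on the Type-I class** (nsreg-p1 ROUND-9): `ω₃ ≡ 0 ↔ ⟪Dv ω, e₃⟫ ≡ 0`. The forward
implication is the frozen constraint (`…FirstIntegral.stub_firstIntegral`, taken as a hypothesis `hfi` to keep this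
file independent of it); the converse is the collapse. -/
theorem poloidal_iff_frozen (hrate : HasTypeITimeDecay C v)
    (hcont : ContinuousOn (uncurry v) (Iio (0 : ℝ) ×ˢ univ))
    (hmild : ∀ s t : ℝ, s < t → t < 0 → ∀ x,
      v t x = UnboundedOperators.heatExtension (v s) (t - s) x - oseenDuhamel 1 s v v t x)
    (hdiv : ∀ t < 0, VectorCalculus.IsDivFree (v t))
    (hfi : (∀ s < 0, ∀ y, ⟪curl (v s) y, EuclideanSpace.single 2 1⟫_ℝ = 0) →
      ∀ s < 0, ∀ y, ⟪fderiv ℝ (v s) y (curl (v s) y), EuclideanSpace.single 2 1⟫_ℝ = 0) :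
    (∀ s < 0, ∀ y, ⟪curl (v s) y, EuclideanSpace.single 2 1⟫_ℝ = 0) ↔
      ∀ s < 0, ∀ y, ⟪fderiv ℝ (v s) y (curl (v s) y), EuclideanSpace.single 2 1⟫_ℝ = 0 := by
  refine ⟨hfi, fun hfrozen s hs y => ?_⟩
  have h := curl_two_eq_zero_of_stretching_two_eq_zero hrate hcont hmild hdiv hfrozen s hs y
  simp [EuclideanSpace.inner_single_right, h]

end Summit.NavierStokesRegularity.NavierStokesRegularity.Theorems.PoloidalWindowDoorPoloidalWindowRigidityErtelCollapse

end
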